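import Summits.CriticalPhenomena.PercolationContinuityZ3.Theorems.PercNearOneGluingNoHeavyLowerTailSahiCombTriWAndMaj3
import Summits.CriticalPhenomena.PercolationContinuityZ3.Theorems.PercNearOneGluingNoHeavyLowerTailSahiCombTriWAndPerfect4Profile

/-!
# AND with the perfect4 block, part 2: the block, its columns, sorted profiles and the six certificate words

Support file of the one-cut programme (crux `NoHeavyLowerTail`, stmt-CriticalPhenomena-4575; unit `prim-lf-1` gen 57, memo
`FROM-prim-lf-1-gen57-PERFECT4.md`).  Part 2 of the perfect4 certificate (part 1: `…AndPerfect4Profile`, the Profile Lemma; part 3: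
`…AndPerfect4`, the theorem).
`perfect4 = x₀(x₁ ∨ x₂ ∨ x₃) ∨ x₁x₂x₃ ⊆ 2^{Fin 4}` (points `⊤`, `⊤−a` (a = 1,2,3), `{1,2,3}`, `{0,a}`) is the self-dual block that resisted
every symbol certificate of gens 43–55.  The certificate below was found by the complete local-certificate LP of gen 57 (max-flow pricing of
unit words) and verified there in exact arithmetic; this file is its Lean transcription in the style of `…AndMaj3`.
* generic columns `p4col A y x = δ_A(x ⊔ y)` of a family `A ⊆ 2^{γ₁ ⊕ Fin 4}`: monotone in `x` and in `y`, values in `[-1,1]`, and the PAIR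
  CONDITION `δ_A(x⊔y) + δ_A(x'⊔y') ≥ 0` whenever `x ∪ x' = ⊤`, `y ∪ y' = ⊤`; named columns `u, g, T_a, p_a`, sorted profiles of the `p`- and
  `T`-triples and their order / pair facts (rank matching);
* the six certificate words `S₂ = p₍₂₎+T₍₂₎`, `S₃ = p₍₃₎+T₍₁₎`, `M = max(g,T₍₃₎)`, `F`, `E`, `u` are increasing with the pair condition;
Part 3 assembles these with the row decomposition, `rearr3` and the Profile Lemma into `corP_andProd_perfect4_nonneg`.
HONEST LABEL: elementary bookkeeping lemmas (indicator arithmetic, `omega` case analyses); standard axioms. [this work]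
-/

namespace Summit.CriticalPhenomena.PercolationContinuityZ3.Theorems

namespace FiveUpSet

open Finset Perfect4Cert

variable {γ₁ : Type} [DecidableEq γ₁] [Fintype γ₁]

/-! ### The block -/

/-- `perfect4 = x₀(x₁ ∨ x₂ ∨ x₃) ∨ x₁x₂x₃` as a family of subsets of `Fin 4` (`0` = centre). [this work] -/
def perfect4 : Finset (Finset (Fin 4)) :=
  {univ, univ.erase 1, univ.erase 2, univ.erase 3, univ.erase 0, {0, 1}, {0, 2}, {0, 3}}

/-- `perfect4` is an up-set. [this work] -/
theorem isUpperSet_perfect4 : IsUpperSet (perfect4 : Set (Finset (Fin 4))) := by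
  intro y y' h hy
  have key : ∀ s ∈ perfect4, ∀ t : Finset (Fin 4), s ⊆ t → t ∈ perfect4 := by decide
  exact key y hy y' h

/-- `perfect4` is antipode-free. [this work] -/
theorem disjoint_perfect4_refl : Disjoint perfect4 (refl perfect4) := by decide

/-- Summing over `perfect4`: top, petal-triple, the three co-atoms `⊤ − a` and the three pairs `{0,a}` (`a = i.succ`). [this work] -/
theorem sum_perfect4 (f : Finset (Fin 4) → ℤ) :
    ∑ y ∈ perfect4, f y = f univ + f (univ.erase 0) + ∑ i : Fin 3, f (univ.erase i.succ) + ∑ i : Fin 3, f {0, i.succ} := by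
  rw [perfect4, Fin.sum_univ_three, Fin.sum_univ_three, sum_insert (by decide), sum_insert (by decide), sum_insert (by decide),
    sum_insert (by decide), sum_insert (by decide), sum_insert (by decide), sum_insert (by decide), sum_singleton]
  show f univ + (f (univ.erase 1) + (f (univ.erase 2) + (f (univ.erase 3) + (f (univ.erase 0) + (f {0, 1} + (f {0, 2} + f {0, 3})))))) =
    f univ + f (univ.erase 0) + (f (univ.erase (1 : Fin 4)) + f (univ.erase (2 : Fin 4)) + f (univ.erase (3 : Fin 4)))
      + (f {0, (1 : Fin 4)} + f {0, (2 : Fin 4)} + f {0, (3 : Fin 4)})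
  ring

/-! ### Generic columns of a family on `2^{γ₁ ⊕ Fin 4}` -/

/-- Column over `y`: `δ_A(x ⊔ y) = [x ⊔ y ∈ A] − [xᶜ ⊔ yᶜ ∈ A]`. [this work] -/
def p4col (A : Finset (Finset (γ₁ ⊕ Fin 4))) (y : Finset (Fin 4)) (x : Finset γ₁) : ℤ := sgnDiff A (refl A) (x.disjSum y)

/-- The column as a difference of indicators. [this work] -/
theorem p4col_eq (A : Finset (Finset (γ₁ ⊕ Fin 4))) (y : Finset (Fin 4)) (x : Finset γ₁) :
    p4col A y x = ind A (x.disjSum y) - ind A (xᶜ.disjSum yᶜ) := by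
  unfold p4col; rw [sgnDiff_refl_eq, compl_disjSum]

/-- Column values lie in `[-1,1]`. [this work] -/
theorem p4col_bounds (A : Finset (Finset (γ₁ ⊕ Fin 4))) (y : Finset (Fin 4)) (x : Finset γ₁) : -1 ≤ p4col A y x ∧ p4col A y x ≤ 1 := by
  rw [p4col_eq]
  have h1 := ind_nonneg_le_one A (x.disjSum y)
  have h2 := ind_nonneg_le_one A (xᶜ.disjSum yᶜ)
  constructor <;> linarith

section colfacts
variable {A : Finset (Finset (γ₁ ⊕ Fin 4))} (hA : IsUpperSet (A : Set (Finset (γ₁ ⊕ Fin 4))))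
include hA

/-- Columns are increasing in the point. [this work] -/
theorem p4col_mono (y : Finset (Fin 4)) {x x' : Finset γ₁} (h : x ⊆ x') : p4col A y x ≤ p4col A y x' := by
  rw [p4col_eq, p4col_eq]
  have h1 := ind_mono_pt hA (disjSum_mono h (le_refl y))
  have h2 := ind_mono_pt hA (disjSum_mono (compl_subset_compl.2 h) (le_refl yᶜ))
  linarith

/-- Columns are increasing in the fibre index. [this work] -/
theorem p4col_mono_fibre {y y' : Finset (Fin 4)} (h : y ⊆ y') (x : Finset γ₁) : p4col A y x ≤ p4col A y' x := by
  rw [p4col_eq, p4col_eq]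
  have h1 := ind_mono_pt hA (disjSum_mono (le_refl x) h)
  have h2 := ind_mono_pt hA (disjSum_mono (le_refl xᶜ) (compl_subset_compl.2 h))
  linarith

/-- **Pair condition**: if `x ∪ x' = ⊤` and `y ∪ y' = ⊤` then `δ_A(x⊔y) + δ_A(x'⊔y') ≥ 0`. [this work] -/
theorem p4col_pair {y y' : Finset (Fin 4)} (hy : y ∪ y' = univ) {x x' : Finset γ₁} (h : x ∪ x' = univ) :
    0 ≤ p4col A y x + p4col A y' x' := by
  rw [p4col_eq, p4col_eq]
  have hc : xᶜ ⊆ x' := by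
    intro a ha; rw [mem_compl] at ha
    have := mem_univ a; rw [← h, mem_union] at this; tauto
  have hc' : x'ᶜ ⊆ x := by
    intro a ha; rw [mem_compl] at ha
    have := mem_univ a; rw [← h, mem_union] at this; tauto
  have hyc : yᶜ ⊆ y' := by
    intro a ha; rw [mem_compl] at ha
    have := mem_univ a; rw [← hy, mem_union] at this; tauto
  have hyc' : y'ᶜ ⊆ y := by
    intro a ha; rw [mem_compl] at ha
    have := mem_univ a; rw [← hy, mem_union] at this; tauto
  have h1 := ind_mono_pt hA (disjSum_mono hc hyc)
  have h2 := ind_mono_pt hA (disjSum_mono hc' hyc')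
  linarith

end colfacts

/-! ### The named columns of the perfect4 block and the sorted profiles -/

/-- Top column `u = δ_A(x ⊔ ⊤)`. [this work] -/
def cU (A : Finset (Finset (γ₁ ⊕ Fin 4))) (x : Finset γ₁) : ℤ := p4col A univ x

/-- Petal column `g = δ_A(x ⊔ {1,2,3})`. [this work] -/
def cG (A : Finset (Finset (γ₁ ⊕ Fin 4))) (x : Finset γ₁) : ℤ := p4col A (univ.erase 0) x

/-- Co-atom column `T_a = δ_A(x ⊔ (⊤ − a))`, `a = i.succ`. [this work] -/
def cT (A : Finset (Finset (γ₁ ⊕ Fin 4))) (i : Fin 3) (x : Finset γ₁) : ℤ := p4col A (univ.erase i.succ) x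

/-- Pair column `p_a = δ_A(x ⊔ {0,a})`, `a = i.succ`. [this work] -/
def cP (A : Finset (Finset (γ₁ ⊕ Fin 4))) (i : Fin 3) (x : Finset γ₁) : ℤ := p4col A {0, i.succ} x

/-- Sorted `p`-profile: minimum. [this work] -/
def pMin (A : Finset (Finset (γ₁ ⊕ Fin 4))) (x : Finset γ₁) : ℤ := min (min (cP A 0 x) (cP A 1 x)) (cP A 2 x)

/-- Sorted `p`-profile: maximum. [this work] -/
def pMax (A : Finset (Finset (γ₁ ⊕ Fin 4))) (x : Finset γ₁) : ℤ := max (max (cP A 0 x) (cP A 1 x)) (cP A 2 x)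

/-- Sorted `p`-profile: median. [this work] -/
def pMed (A : Finset (Finset (γ₁ ⊕ Fin 4))) (x : Finset γ₁) : ℤ := cP A 0 x + cP A 1 x + cP A 2 x - pMin A x - pMax A x

/-- Sorted `T`-profile: minimum. [this work] -/
def tMin (A : Finset (Finset (γ₁ ⊕ Fin 4))) (x : Finset γ₁) : ℤ := min (min (cT A 0 x) (cT A 1 x)) (cT A 2 x)

/-- Sorted `T`-profile: maximum. [this work] -/
def tMax (A : Finset (Finset (γ₁ ⊕ Fin 4))) (x : Finset γ₁) : ℤ := max (max (cT A 0 x) (cT A 1 x)) (cT A 2 x)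

/-- Sorted `T`-profile: median. [this work] -/
def tMed (A : Finset (Finset (γ₁ ⊕ Fin 4))) (x : Finset γ₁) : ℤ := cT A 0 x + cT A 1 x + cT A 2 x - tMin A x - tMax A x

/-- Word `S₂ = p₍₂₎ + T₍₂₎`. [this work] -/
def wS2 (A : Finset (Finset (γ₁ ⊕ Fin 4))) (x : Finset γ₁) : ℤ := pMed A x + tMed A x

/-- Word `S₃ = p₍₃₎ + T₍₁₎`. [this work] -/
def wS3 (A : Finset (Finset (γ₁ ⊕ Fin 4))) (x : Finset γ₁) : ℤ := pMax A x + tMin A x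

/-- Word `M = max(g, T₍₃₎)`. [this work] -/
def wM (A : Finset (Finset (γ₁ ⊕ Fin 4))) (x : Finset γ₁) : ℤ := max (cG A x) (tMax A x)

/-- Word `F` of the certificate (part 1, `wF`) composed with the profile. [this work] -/
def wFx (A : Finset (Finset (γ₁ ⊕ Fin 4))) (x : Finset γ₁) : ℤ := wF (cG A x) (pMin A x) (tMax A x)

/-- Word `E` of the certificate (part 1, `wE`) composed with the profile. [this work] -/
def wEx (A : Finset (Finset (γ₁ ⊕ Fin 4))) (x : Finset γ₁) : ℤ := wE (cG A x) (pMin A x) (tMin A x) (tMax A x)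

/-! ### Abstract facts about the words `F`, `E` as functions of integers -/

/-- `F` is monotone in its arguments (on `[-1,1]`). [this work] -/
theorem wF_mono {g p T g' p' T' : ℤ} (hg : g ≤ g') (hp : p ≤ p') (hT : T ≤ T') (bg : -1 ≤ g) (bg' : g' ≤ 1) (bp : -1 ≤ p) (bp' : p' ≤ 1)
    (bT : -1 ≤ T) :
    wF g p T ≤ wF g' p' T' := by
  unfold wF; split_ifs <;> omega

/-- `E` is monotone in its arguments (on `[-1,1]`). [this work] -/
theorem wE_mono {g p t T g' p' t' T' : ℤ} (hg : g ≤ g') (hp : p ≤ p') (ht : t ≤ t') (hT : T ≤ T') (bg : -1 ≤ g) (bg' : g' ≤ 1)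
    (bp : -1 ≤ p) (bp' : p' ≤ 1) (bT : -1 ≤ T) (bT' : T' ≤ 1) :
    wE g p t T ≤ wE g' p' t' T' := by
  unfold wE; split_ifs <;> omega

/-- Values of `F`. [this work] -/
theorem wF_vals (g p T : ℤ) : wF g p T = -1 ∨ wF g p T = 0 ∨ wF g p T = 1 := by
  unfold wF; split_ifs <;> omega

/-- Values of `E`. [this work] -/
theorem wE_vals (g p t T : ℤ) : wE g p t T = -1 ∨ wE g p t T = 0 ∨ wE g p t T = 1 := by
  unfold wE; split_ifs <;> omega

/-- Pair condition for `F` from the pair facts between `p₍₁₎`, `g`, `T₍₃₎` at two points covering `⊤`. [this work] -/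
theorem wF_pair {g p T g' p' T' : ℤ} (bg : -1 ≤ g) (bg1 : g ≤ 1) (bp : -1 ≤ p) (bp1 : p ≤ 1) (bT : -1 ≤ T) (bT1 : T ≤ 1)
    (bg' : -1 ≤ g') (bg1' : g' ≤ 1) (bp' : -1 ≤ p') (bp1' : p' ≤ 1) (bT' : -1 ≤ T') (bT1' : T' ≤ 1)
    (h1 : 0 ≤ p + g') (h2 : 0 ≤ g + p') (h3 : 0 ≤ p + T') (h4 : 0 ≤ T + p') :
    0 ≤ wF g p T + wF g' p' T' := by
  unfold wF; split_ifs <;> omega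

/-- Pair condition for `E` from the pair facts between `p₍₁₎`, `g`, `T₍₁₎`, `T₍₃₎` at two points covering `⊤`. [this work] -/
theorem wE_pair {g p t T g' p' t' T' : ℤ} (bg : -1 ≤ g) (bg1 : g ≤ 1) (bp : -1 ≤ p) (bp1 : p ≤ 1) (btT : t ≤ T) (bT1 : T ≤ 1) (bt : -1 ≤ t)
    (bg' : -1 ≤ g') (bg1' : g' ≤ 1) (bp' : -1 ≤ p') (bp1' : p' ≤ 1) (btT' : t' ≤ T') (bT1' : T' ≤ 1) (bt' : -1 ≤ t')
    (h1 : 0 ≤ p + g') (h2 : 0 ≤ g + p') (h3 : 0 ≤ p + T') (h4 : 0 ≤ T + p') (h5 : 0 ≤ g + t') (h6 : 0 ≤ t + g')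
    (h7 : 0 ≤ T + t') (h8 : 0 ≤ t + T') :
    0 ≤ wE g p t T + wE g' p' t' T' := by
  unfold wE; split_ifs <;> omega

section facts
variable {A : Finset (Finset (γ₁ ⊕ Fin 4))} (hA : IsUpperSet (A : Set (Finset (γ₁ ⊕ Fin 4))))

/-- Bounds of the named columns. [this work] -/
theorem cols_bounds (x : Finset γ₁) :
    (-1 ≤ cU A x ∧ cU A x ≤ 1) ∧ (-1 ≤ cG A x ∧ cG A x ≤ 1) ∧ (∀ i : Fin 3, (-1 ≤ cP A i x ∧ cP A i x ≤ 1) ∧ (-1 ≤ cT A i x ∧ cT A i x ≤ 1)) :=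
  ⟨p4col_bounds A _ x, p4col_bounds A _ x, fun _ => ⟨p4col_bounds A _ x, p4col_bounds A _ x⟩⟩

/-- Bounds of the six profile statistics. [this work] -/
theorem stats_bounds (x : Finset γ₁) :
    (-1 ≤ pMin A x ∧ pMin A x ≤ 1) ∧ (-1 ≤ pMed A x ∧ pMed A x ≤ 1) ∧ (-1 ≤ pMax A x ∧ pMax A x ≤ 1)
      ∧ (-1 ≤ tMin A x ∧ tMin A x ≤ 1) ∧ (-1 ≤ tMed A x ∧ tMed A x ≤ 1) ∧ (-1 ≤ tMax A x ∧ tMax A x ≤ 1) := by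
  obtain ⟨_, _, hi⟩ := cols_bounds (A := A) x
  have h0 := hi 0; have h1 := hi 1; have h2 := hi 2
  unfold pMed pMin pMax tMed tMin tMax
  refine ⟨⟨?_, ?_⟩, ⟨?_, ?_⟩, ⟨?_, ?_⟩, ⟨?_, ?_⟩, ⟨?_, ?_⟩, ⟨?_, ?_⟩⟩ <;> omega

/-- `p₍₁₎ ≤ p₍₂₎ ≤ p₍₃₎` and `T₍₁₎ ≤ T₍₂₎ ≤ T₍₃₎`. [this work] -/
theorem stats_sorted (x : Finset γ₁) :
    pMin A x ≤ pMed A x ∧ pMed A x ≤ pMax A x ∧ tMin A x ≤ tMed A x ∧ tMed A x ≤ tMax A x := by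
  unfold pMed pMin pMax tMed tMin tMax
  refine ⟨?_, ?_, ?_, ?_⟩ <;> omega

include hA

/-- Order facts: `g ≤ u`, `T₍₃₎ ≤ u`, `p₍₃₎ ≤ u`, `p₍₂₎ ≤ T₍₁₎`, `p₍₃₎ ≤ T₍₂₎`. [this work] -/
theorem stats_order (x : Finset γ₁) :
    cG A x ≤ cU A x ∧ tMax A x ≤ cU A x ∧ pMax A x ≤ cU A x ∧ pMed A x ≤ tMin A x ∧ pMax A x ≤ tMed A x := by
  have hgu : cG A x ≤ cU A x := p4col_mono_fibre hA (subset_univ _) x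
  have ht : ∀ i : Fin 3, cT A i x ≤ cU A x := fun i => p4col_mono_fibre hA (subset_univ _) x
  have hp : ∀ i : Fin 3, cP A i x ≤ cU A x := fun i => p4col_mono_fibre hA (subset_univ _) x
  have hpt : ∀ i j : Fin 3, i ≠ j → cP A i x ≤ cT A j x := by
    intro i j hij
    have hs : ({0, i.succ} : Finset (Fin 4)) ⊆ univ.erase j.succ := by
      fin_cases i <;> fin_cases j <;> first | exact absurd rfl hij | decide
    exact p4col_mono_fibre hA hs x
  have t0 := ht 0; have t1 := ht 1; have t2 := ht 2; have q0 := hp 0; have q1 := hp 1; have q2 := hp 2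
  have o01 := hpt 0 1 (by decide); have o02 := hpt 0 2 (by decide); have o10 := hpt 1 0 (by decide)
  have o12 := hpt 1 2 (by decide); have o20 := hpt 2 0 (by decide); have o21 := hpt 2 1 (by decide)
  refine ⟨hgu, ?_, ?_, ?_, ?_⟩
  · unfold tMax; omega
  · unfold pMax; omega
  · unfold pMed pMin pMax tMin; omega
  · unfold pMax tMed tMin tMax; omega

/-- Monotonicity of the columns and statistics in the point. [this work] -/
theorem stats_mono {x x' : Finset γ₁} (h : x ⊆ x') :
    cU A x ≤ cU A x' ∧ cG A x ≤ cG A x' ∧ pMin A x ≤ pMin A x' ∧ pMed A x ≤ pMed A x' ∧ pMax A x ≤ pMax A x'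
      ∧ tMin A x ≤ tMin A x' ∧ tMed A x ≤ tMed A x' ∧ tMax A x ≤ tMax A x' := by
  have hp : ∀ i : Fin 3, cP A i x ≤ cP A i x' := fun i => p4col_mono hA _ h
  have ht : ∀ i : Fin 3, cT A i x ≤ cT A i x' := fun i => p4col_mono hA _ h
  have p0 := hp 0; have p1 := hp 1; have p2 := hp 2; have t0 := ht 0; have t1 := ht 1; have t2 := ht 2
  refine ⟨p4col_mono hA _ h, p4col_mono hA _ h, ?_, ?_, ?_, ?_, ?_, ?_⟩
  · unfold pMin; omega
  · unfold pMed pMin pMax; simp only [min_def, max_def]; split_ifs <;> omega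
  · unfold pMax; omega
  · unfold tMin; omega
  · unfold tMed tMin tMax; simp only [min_def, max_def]; split_ifs <;> omega
  · unfold tMax; omega

/-- **Pair facts between the statistics** at two points covering `⊤` (rank matching: `p_a ~ T_a`, `p_a ~ g`, `T_a ~ g`, `T_a ~ T_b`,
`u ~ ⊤`). [this work] -/
theorem stats_pair {x x' : Finset γ₁} (h : x ∪ x' = univ) :
    0 ≤ pMed A x + tMed A x' ∧ 0 ≤ pMax A x + tMin A x' ∧ 0 ≤ pMin A x + cG A x' ∧ 0 ≤ pMin A x + tMax A x'
      ∧ 0 ≤ cG A x + tMin A x' ∧ 0 ≤ tMax A x + tMin A x' ∧ 0 ≤ cU A x + cU A x' := by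
  have hPT : ∀ i : Fin 3, 0 ≤ cP A i x + cT A i x' := by
    intro i
    have hy : ({0, i.succ} : Finset (Fin 4)) ∪ univ.erase i.succ = univ := by fin_cases i <;> decide
    exact p4col_pair hA hy h
  have hPG : ∀ i : Fin 3, 0 ≤ cP A i x + cG A x' := by
    intro i
    have hy : ({0, i.succ} : Finset (Fin 4)) ∪ univ.erase 0 = univ := by fin_cases i <;> decide
    exact p4col_pair hA hy h
  have hGT : ∀ i : Fin 3, 0 ≤ cG A x + cT A i x' := by
    intro i
    have hy : univ.erase (0 : Fin 4) ∪ univ.erase i.succ = univ := by fin_cases i <;> decide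
    exact p4col_pair hA hy h
  have hTT : ∀ i j : Fin 3, i ≠ j → 0 ≤ cT A i x + cT A j x' := by
    intro i j hij
    have hy : univ.erase i.succ ∪ univ.erase j.succ = (univ : Finset (Fin 4)) := by
      fin_cases i <;> fin_cases j <;> first | exact absurd rfl hij | decide
    exact p4col_pair hA hy h
  have hUU : 0 ≤ cU A x + cU A x' := p4col_pair hA (by simp) h
  have a0 := hPT 0; have a1 := hPT 1; have a2 := hPT 2; have b0 := hPG 0; have b1 := hPG 1; have b2 := hPG 2
  have c0 := hGT 0; have c1 := hGT 1; have c2 := hGT 2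
  have t01 := hTT 0 1 (by decide); have t02 := hTT 0 2 (by decide); have t10 := hTT 1 0 (by decide)
  have t12 := hTT 1 2 (by decide); have t20 := hTT 2 0 (by decide); have t21 := hTT 2 1 (by decide)
  refine ⟨?_, ?_, ?_, ?_, ?_, ?_, hUU⟩
  · unfold pMed pMin pMax tMed tMin tMax; simp only [min_def, max_def]; split_ifs <;> omega
  · unfold pMax tMin; omega
  · unfold pMin; omega
  · unfold pMin tMax; omega
  · unfold tMin; omega
  · unfold tMax tMin; omega

/-- The six words are increasing in the point. [this work] -/
theorem words_mono {x x' : Finset γ₁} (h : x ⊆ x') :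
    wS2 A x ≤ wS2 A x' ∧ wS3 A x ≤ wS3 A x' ∧ wM A x ≤ wM A x' ∧ wFx A x ≤ wFx A x' ∧ wEx A x ≤ wEx A x' ∧ cU A x ≤ cU A x' := by
  obtain ⟨hu, hg, h1, h2, h3, h4, h5, h6⟩ := stats_mono hA h
  obtain ⟨_, bg, _⟩ := cols_bounds (A := A) x
  obtain ⟨_, bg', _⟩ := cols_bounds (A := A) x'
  obtain ⟨bpm, _, _, _, _, btM⟩ := stats_bounds (A := A) x
  obtain ⟨bpm', _, _, _, _, btM'⟩ := stats_bounds (A := A) x'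
  refine ⟨by unfold wS2; omega, by unfold wS3; omega, by unfold wM; omega, ?_, ?_, hu⟩
  · exact wF_mono hg h1 h6 bg.1 bg'.2 bpm.1 bpm'.2 btM.1
  · exact wE_mono hg h1 h4 h6 bg.1 bg'.2 bpm.1 bpm'.2 btM.1 btM'.2

omit hA in
/-- Bounds / values of the six words. [this work] -/
theorem words_bounds (x : Finset γ₁) :
    (-2 ≤ wS2 A x ∧ wS2 A x ≤ 2) ∧ (-2 ≤ wS3 A x ∧ wS3 A x ≤ 2) ∧ (wM A x = -1 ∨ wM A x = 0 ∨ wM A x = 1)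
      ∧ (wFx A x = -1 ∨ wFx A x = 0 ∨ wFx A x = 1) ∧ (wEx A x = -1 ∨ wEx A x = 0 ∨ wEx A x = 1)
      ∧ (cU A x = -1 ∨ cU A x = 0 ∨ cU A x = 1) := by
  obtain ⟨bu, bg, _⟩ := cols_bounds (A := A) x
  obtain ⟨bpm, bpd, bpM, btm, btd, btM⟩ := stats_bounds (A := A) x
  refine ⟨by unfold wS2; omega, by unfold wS3; omega, by unfold wM; omega, wF_vals _ _ _, wE_vals _ _ _ _, by omega⟩

/-- **Pair conditions of the six words**: `x ∪ x' = ⊤ ⟹ w(x) + w(x') ≥ 0`. [this work] -/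
theorem words_pair {x x' : Finset γ₁} (h : x ∪ x' = univ) :
    0 ≤ wS2 A x + wS2 A x' ∧ 0 ≤ wS3 A x + wS3 A x' ∧ 0 ≤ wM A x + wM A x' ∧ 0 ≤ wFx A x + wFx A x' ∧ 0 ≤ wEx A x + wEx A x'
      ∧ 0 ≤ cU A x + cU A x' := by
  have h' : x' ∪ x = univ := by rw [union_comm]; exact h
  obtain ⟨a1, a2, a3, a4, a5, a6, huu⟩ := stats_pair hA h
  obtain ⟨b1, b2, b3, b4, b5, b6, _⟩ := stats_pair hA h'
  obtain ⟨_, bg, _⟩ := cols_bounds (A := A) x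
  obtain ⟨_, bg', _⟩ := cols_bounds (A := A) x'
  obtain ⟨bpm, _, _, btm, _, btM⟩ := stats_bounds (A := A) x
  obtain ⟨bpm', _, _, btm', _, btM'⟩ := stats_bounds (A := A) x'
  obtain ⟨_, _, st1, st2⟩ := stats_sorted (A := A) x
  obtain ⟨_, _, st1', st2'⟩ := stats_sorted (A := A) x'
  refine ⟨by unfold wS2; omega, by unfold wS3; omega, by unfold wM; omega, ?_, ?_, huu⟩
  · exact wF_pair bg.1 bg.2 bpm.1 bpm.2 btM.1 btM.2 bg'.1 bg'.2 bpm'.1 bpm'.2 btM'.1 btM'.2 a3 (by linarith [b3]) a4 (by linarith [b4])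
  · exact wE_pair bg.1 bg.2 bpm.1 bpm.2 (le_trans st1 st2) btM.2 btm.1 bg'.1 bg'.2 bpm'.1 bpm'.2 (le_trans st1' st2') btM'.2 btm'.1
      a3 (by linarith [b3]) a4 (by linarith [b4]) a5 (by linarith [b5]) a6 (by linarith [b6])

end facts

end FiveUpSet

end Summit.CriticalPhenomena.PercolationContinuityZ3.Theorems
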